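import Mathlib
import Literature.NumberTheory.Transcendental.ZagierDilogarithmConjecture
import Literature.NumberTheory.Transcendental.BlochWignerDilogarithm
import Summits.KontsevichZagierPeriods.KontsevichZagierPeriods.Theorems.HyperbolicBlochZagierDilogarithmConjectureCyclotomicMilnor
import Summits.KontsevichZagierPeriods.KontsevichZagierPeriods.Theorems.HyperbolicBlochZagierDilogarithmConjectureStubMilnorFiveIffIrrational
import Summits.KontsevichZagierPeriods.KontsevichZagierPeriods.Theorems.HyperbolicBlochZagierDilogarithmConjectureStubMilnorEightIffIrrational
import Summits.KontsevichZagierPeriods.KontsevichZagierPeriods.Theorems.HyperbolicBlochZagierDilogarithmConjectureStubMilnorTwelveIffIrrational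
import HarnessLib

/-!
# `ZagierDilogarithmConjecture` (stmt-KontsevichZagierPeriods-10550) — line `kummer-clausen-linearisation`
(reshape c5, "the cyclotomic tower and the abelian sector"), stub `stub_crux_irrational`

**Three classical open irrationality problems decided by the crux.** Let `D` be the Bloch–Wigner
dilogarithm (`blochWignerDilog`), `ζ_N = e^{2πi/N}`, `Cl₂` the Clausen function (`D(e^{iθ}) = Cl₂(θ)`)
and `G = D(i) = Cl₂(π/2)` Catalan's constant. If Zagier's dilogarithm conjecture (the route decl
`ZagierDilogarithmConjecture`, Neumann 1998 §2.1) holds, then the three real numbers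

* `D(ζ₅²)/D(ζ₅) = Cl₂(4π/5)/Cl₂(2π/5)`,
* `D(i)/D(ζ₈) = G/Cl₂(π/4)`,
* `D(i)/D(ζ₆) = G/Cl₂(π/3) = vol(Whitehead link complement)/(2·vol(figure-eight knot complement))`

are irrational. Each is an open problem today.

Proof: pure composition of landed theorems of this line. The crux implies Milnor's conjecture
(`ℤ`-form) at every level `N` (`crux_implies_milnor`, c4: the crux makes every `ℤ`-relation among the
primitive Clausen values `D(ζ_N^c)`, `c ∈ (ℤ/N)ˣ`, `0 < c < N/2`, explained, and the unconditional
cyclotomic independence theorem kills explained primitive relations), and Milnor's conjecture at the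
levels `5`, `8`, `12` is respectively EXACTLY one of the three irrationality statements above
(`stub_milnorFive_iff_irrational`, `stub_milnorEight_iff_irrational`, `stub_milnorTwelve_iff_irrational`,
c5: two admissible residues at each of these levels, `D > 0` on `ℍ⁺`, and the duplication / distribution
value identities `2(D(ζ₈) − D(ζ₈³)) = D(i)`, `3(D(ζ₁₂) + D(ζ₁₂⁵)) = 4D(i)`, `2(D(ζ₁₂) − D(ζ₁₂⁵)) = D(ζ₆)`
folding the pair of primitive values onto `D(i)`, `D(ζ₈)` resp. `D(i)`, `D(ζ₆)`).
Sorry-free; axioms ⊆ {propext, Classical.choice, Quot.sound}.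

## References

* W. D. Neumann, *Hilbert's 3rd problem and invariants of 3-manifolds*, Geom. Topol. Monogr. 1 (1998),
  §2.1. [Neumann1998]
* J. Milnor, *Hyperbolic geometry: the first 150 years*, Bull. AMS 6 (1982), Appendix (the conjecture
  on the values `Л(πc/N)`; `Л(π/3)`, `Л(π/4)` and the volumes of the figure-eight and Whitehead link
  complements). [Milnor1982]
-/

noncomputable section

open scoped BigOperators ComplexConjugate
open Literature.NumberTheory.Transcendental

namespace Summit.KontsevichZagierPeriods.HyperbolicBloch.ZagierDilogarithmCyclotomic

/-- **Stub `stub_crux_irrational` (c5): Zagier's dilogarithm conjecture decides three classical open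
irrationality problems.** If the crux holds then `Cl₂(4π/5)/Cl₂(2π/5) = D(ζ₅²)/D(ζ₅)`,
`G/Cl₂(π/4) = D(i)/D(ζ₈)` (`G = D(i)` Catalan's constant) and
`G/Cl₂(π/3) = D(i)/D(ζ₆) = vol(Whitehead link complement)/(2·vol(figure-eight knot complement))` are
all irrational: the crux gives Milnor's conjecture at every level (`crux_implies_milnor`), and at the
levels `5`, `8`, `12` Milnor's conjecture is exactly the respective irrationality statement
(`stub_milnorFive_iff_irrational`, `stub_milnorEight_iff_irrational`, `stub_milnorTwelve_iff_irrational`).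
[cite: Milnor1982, Appendix] [cite: Neumann1998, §2.1] -/
theorem stub_crux_irrational :
    Summit.KontsevichZagierPeriods.KontsevichZagierPeriods.Theses.HyperbolicBloch.ZagierDilogarithmConjecture →
      Irrational (blochWignerDilog (Complex.exp (2 * Real.pi * Complex.I / 5) ^ 2) /
          blochWignerDilog (Complex.exp (2 * Real.pi * Complex.I / 5))) ∧
        Irrational (blochWignerDilog Complex.I / blochWignerDilog (Complex.exp (2 * Real.pi * Complex.I / 8))) ∧
          Irrational (blochWignerDilog Complex.I / blochWignerDilog (Complex.exp (2 * Real.pi * Complex.I / 6))) := by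
  intro h
  have h5 := crux_implies_milnor h 5
  have h8 := crux_implies_milnor h 8
  have h12 := crux_implies_milnor h 12
  simp only [Nat.cast_ofNat] at h5 h8 h12
  exact ⟨stub_milnorFive_iff_irrational.1 h5, stub_milnorEight_iff_irrational.1 h8,
    stub_milnorTwelve_iff_irrational.1 h12⟩

end Summit.KontsevichZagierPeriods.HyperbolicBloch.ZagierDilogarithmCyclotomic

end
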